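import Mathlib
import Literature.Barriers.ValiantsHypothesis.AlgebraicNaturalProofs
import Literature.Computability.AlgebraicComplexity.ArithCircuitProofs
import Summits.ValiantsHypothesis.ValiantsHypothesis.Theorems.BarrierLeverPartitionMinorsHitByVPAutomorphicLayouts
import Summits.ValiantsHypothesis.ValiantsHypothesis.Theorems.BarrierLeverPartitionMinorsHitByVPSplitDoorAssembled
import Summits.ValiantsHypothesis.ValiantsHypothesis.Theorems.BarrierLeverPartitionMinorsHitByVPStrataDoor
import Summits.ValiantsHypothesis.ValiantsHypothesis.Theses.BarrierLever

/-!
# Route BarrierLever — item `PartitionMinorsHitByVP` (stmt-ValiantsHypothesis-19717):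
# STRATIFIED layouts — the m-strata door in the item's coordinates and the first classes it
# closes unconditionally: AUTOMORPHIC STRATA and UNIONS OF HAMMING-WEIGHT CLASSES

Helper file (`--supports stmt-ValiantsHypothesis-19717`; cell valiant-natproofs, rung V4, 𝒟-side,
prover seat val-np-p6 gen 0). Definition-free. Closes NO item.

* `partitionMinor_hit_of_strata_perm` — the door `…StrataDoor.partitionMinor_hit_of_strata` for
  `u w : Fin r → Finset (Fin h)` with row strata `lr`, column strata `lc` and a permutation `e` of
  `Fin r` carrying row stratum `t` onto column stratum `π t` (`lc (e i) = π (lr i)`).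
* `cell_det_twistedDiag_ne_zero'` — an AUTOMORPHIC stratum (`w (e i) = σ((u i) ∆ s)` on the
  stratum) has the identity as cell matrix at the twisted diagonal state of `…Automorphic`.
* `strata_budget` — the size arithmetic `m·((h+h)^k + (h+h) + 2) ≤ (h+h)^(c+k+1)`.
* **`partitionMinor_hit_of_automorphicStrata`** (UNCONDITIONAL CLASS) — `m ≤ (h+h)^c` strata of one
  threshold pair, each an automorphic image under ITS OWN cube automorphism `(σ_t, s_t)`, any
  injective matching `π` of row strata to column strata ⇒ hit inside `SmallCircuits ℂ (h+h) (c+3)`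
  (`h ≥ 1`). The two-strata case is `…SplitDoor.partitionMinor_hit_of_piecewiseAutomorphic`
  (p443757); here the number of strata may grow with `h` because the door is additive in size.
* **`partitionMinor_hit_of_weightClasses`** (UNCONDITIONAL CLASS) — rows = ALL subsets with
  cardinality in `A`, columns = ALL subsets with cardinality in `τ(A)`, `τ k ∈ {k, h − k}` injective
  on `A` ⇒ hit inside `SmallCircuits ℂ (h+h) 4` (`h ≥ 1`; strata = weights, `λ = μ = 𝟙`, stratum `k`
  principal if `τ k = k`, antipodal if `τ k = h − k`; the matching permutation is constructed here).
  This class contains the TT-IRREDUCIBLE (item 19616: no R1 literal-pair split, no R2 twin-free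
  pair) census examples of kit j253855 — `W₀∪W₁ v W₀∪W₃` (`h = 4`), `W₁∪W₂ v W₁∪W₃`,
  `W₁∪W₅ v W₄∪W₅` (`h = 5`) with `τ = (0 ↦ 0, 1 ↦ 3)`, `(1 ↦ 1, 2 ↦ 3)`, `(1 ↦ 4, 5 ↦ 5)` — so the
  weight cut `λ = 𝟙`, which is not an R1 move (R1 = the cut `λ = ±e_a`), disposes for item 19717 of
  layouts on which the TT reductions R1/R2 are silent. The residue of the strata door and the
  conditional door of record are in `…StrataLeaves.lean`.

WHAT THIS IS NOT: structured classes only; nothing here bears on TT / item 19616 itself (these are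
19717-witnesses, not transversal minors), on crux 14610 or on VP vs VNP.
-/

set_option linter.dupNamespace false

namespace Summit.ValiantsHypothesis.ValiantsHypothesis.Theorems.BarrierLever.StrataDoor

open Finset
open Literature.Barriers.ValiantsHypothesis Literature.Computability.AlgebraicComplexity
open Summit.ValiantsHypothesis.ValiantsHypothesis.Theorems.BarrierLever.Automorphic
  (coeff_twistedDiag twistedDiag_mem_smallCircuits)
open Summit.ValiantsHypothesis.ValiantsHypothesis.Theorems.BarrierLever.SplitDoor
  (leaf_hit smallCircuits_mono)

variable {h r : ℕ}

/-! ## 1. The door in the item's coordinates -/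

/-- **Strata door, `Fin r` form.** Row strata `lr`, column strata `lc`, a permutation `e` of `Fin r`
with `lc (e i) = π (lr i)`; per-stratum witnesses `F t` nonsingular on the cells
(rows `{i // lr i = t}`, columns `e i'`) ⇒ one witness for the whole layout matrix of item 19717,
size `≤ Σ_{t<m} L(F t) + m(2h+2)`, degree `≤ max deg (F t)`. -/
theorem partitionMinor_hit_of_strata_perm (m : ℕ) (u w : Fin r → Finset (Fin h))
    (lam mu : Fin h → ℤ) (lr lc : Fin r → ℕ) (π : ℕ → ℕ) (e : Equiv.Perm (Fin r))
    (he : ∀ i, lc (e i) = π (lr i)) (hπ : ∀ i j : Fin r, π (lr i) = π (lr j) → lr i = lr j)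
    (hlr : ∀ i, lr i < m) (cr cc : ℕ → ℤ) (hcr : Monotone cr) (hcc : Monotone cc)
    (hrow : ∀ i, cr (lr i) < ∑ a ∈ u i, lam a ∧ ∑ a ∈ u i, lam a ≤ cr (lr i + 1))
    (hcol : ∀ j, cc (lc j) < ∑ c ∈ w j, mu c ∧ ∑ c ∈ w j, mu c ≤ cc (lc j + 1))
    (F : ℕ → MvPolynomial (Fin (h + h)) ℂ)
    (hdet : ∀ t < m, (Matrix.of fun i i' : {i // lr i = t} => MvPolynomial.coeff
        (∑ a ∈ u i.1, Finsupp.single (Fin.castAdd h a) 1 +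
          ∑ c ∈ w (e i'.1), Finsupp.single (Fin.natAdd h c) 1) (F t)).det ≠ 0) :
    ∃ f : MvPolynomial (Fin (h + h)) ℂ,
      f.totalDegree ≤ (Finset.range m).sup (fun t => (F t).totalDegree) ∧
      complexity f ≤ ∑ t ∈ Finset.range m, complexity (F t) + m * (h + h + 2) ∧
      (Matrix.of fun i j : Fin r => MvPolynomial.coeff
        (∑ a ∈ u i, Finsupp.single (Fin.castAdd h a) 1 +
          ∑ c ∈ w j, Finsupp.single (Fin.natAdd h c) 1) f).det ≠ 0 := by
  classical
  obtain ⟨f, hdeg, hsize, hne⟩ := partitionMinor_hit_of_strata h m u (fun i => w (e i)) lam mu lr π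
    hπ hlr cr cc hcr hcc hrow (fun j => by rw [← he j]; exact hcol (e j)) F hdet
  refine ⟨f, hdeg, hsize, ?_⟩
  set M : Matrix (Fin r) (Fin r) ℂ := Matrix.of fun i j : Fin r => MvPolynomial.coeff
    (∑ a ∈ u i, Finsupp.single (Fin.castAdd h a) 1 + ∑ c ∈ w j, Finsupp.single (Fin.natAdd h c) 1) f
    with hM
  have hsub : (Matrix.of fun i j : Fin r => MvPolynomial.coeff
      (∑ a ∈ u i, Finsupp.single (Fin.castAdd h a) 1 +
        ∑ c ∈ w (e j), Finsupp.single (Fin.natAdd h c) 1) f) = M.submatrix id e := by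
    ext i j
    rfl
  rw [hsub, Matrix.det_permute'] at hne
  intro h0
  exact hne (by rw [h0, mul_zero])

/-! ## 2. Automorphic strata -/

/-- An automorphic stratum (`w (e i) = σ((u i) ∆ s)` for the rows `i` of stratum `t`) has the
identity as its cell matrix at the twisted diagonal state `f_{(σ,s)}`; in particular it is
nonsingular. -/
theorem cell_det_twistedDiag_ne_zero' (u w : Fin r → Finset (Fin h)) (hu : Function.Injective u)
    (lr : Fin r → ℕ) (e : Equiv.Perm (Fin r)) (t : ℕ) (σ : Equiv.Perm (Fin h)) (s : Finset (Fin h))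
    (hw : ∀ i : {i // lr i = t}, w (e i.1) = (symmDiff (u i.1) s).image σ) :
    (Matrix.of fun i i' : {i // lr i = t} => MvPolynomial.coeff
        (∑ a ∈ u i.1, Finsupp.single (Fin.castAdd h a) 1 +
          ∑ c ∈ w (e i'.1), Finsupp.single (Fin.natAdd h c) 1)
        (∏ a : Fin h, (if a ∈ s then MvPolynomial.X (Fin.natAdd h (σ a)) + MvPolynomial.X (Fin.castAdd h a)
          else 1 + MvPolynomial.X (Fin.castAdd h a) * MvPolynomial.X (Fin.natAdd h (σ a))) :
          MvPolynomial (Fin (h + h)) ℂ)).det ≠ 0 := by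
  classical
  have hinj : ∀ A B : Finset (Fin h), (symmDiff A s).image σ = (symmDiff B s).image σ ↔ A = B := by
    intro A B
    constructor
    · intro hAB
      have h1 : symmDiff A s = symmDiff B s := (Finset.image_injective σ.injective) hAB
      simpa [symmDiff_left_inj] using congrArg (fun C => symmDiff C s) h1
    · rintro rfl
      rfl
  have hM : (Matrix.of fun i i' : {i // lr i = t} => MvPolynomial.coeff
        (∑ a ∈ u i.1, Finsupp.single (Fin.castAdd h a) 1 +
          ∑ c ∈ w (e i'.1), Finsupp.single (Fin.natAdd h c) 1)
        (∏ a : Fin h, (if a ∈ s then MvPolynomial.X (Fin.natAdd h (σ a)) + MvPolynomial.X (Fin.castAdd h a)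
          else 1 + MvPolynomial.X (Fin.castAdd h a) * MvPolynomial.X (Fin.natAdd h (σ a))) :
          MvPolynomial (Fin (h + h)) ℂ)) = 1 := by
    ext i i'
    rw [Matrix.of_apply, coeff_twistedDiag, hw i', Matrix.one_apply]
    simp only [hinj, hu.eq_iff]
    by_cases hii : i = i'
    · subst hii
      simp
    · rw [if_neg (fun hh => hii (Subtype.ext hh).symm), if_neg hii]
  rw [hM, Matrix.det_one]
  exact one_ne_zero

/-- Arithmetic of the size budget: `m · ((h+h)^k + (h+h) + 2) ≤ (h+h)^(c+k+1)` for `m ≤ (h+h)^c`,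
`h ≥ 1`, `k ≥ 2`. -/
theorem strata_budget (c k m : ℕ) (hh : 1 ≤ h) (hk : 2 ≤ k) (hm : m ≤ (h + h) ^ c) :
    m * ((h + h) ^ k + (h + h) + 2) ≤ (h + h) ^ (c + k + 1) := by
  have h2 : 2 ≤ h + h := by omega
  have hpk : (h + h) + 2 ≤ (h + h) ^ k := by
    calc (h + h) + 2 ≤ (h + h) * (h + h) := by nlinarith
      _ = (h + h) ^ 2 := by ring
      _ ≤ (h + h) ^ k := Nat.pow_le_pow_right (by omega) hk
  calc m * ((h + h) ^ k + (h + h) + 2) ≤ (h + h) ^ c * ((h + h) ^ k + (h + h) + 2) :=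
        Nat.mul_le_mul_right _ hm
    _ ≤ (h + h) ^ c * ((h + h) ^ k + (h + h) ^ k) := by
        apply Nat.mul_le_mul_left
        omega
    _ = (h + h) ^ c * (2 * (h + h) ^ k) := by ring
    _ ≤ (h + h) ^ c * ((h + h) * (h + h) ^ k) := by gcongr
    _ = (h + h) ^ (c + k + 1) := by ring

/-- **Automorphic strata are hit** (`b = c + 3`): `m ≤ (h+h)^c` strata of one threshold pair
`(λ, μ)`, matched by `π` along a permutation `e`, stratum `t` automorphic under its own cube
automorphism `(σ t, S t)` — `w (e i) = σ_{lr i}((u i) ∆ S_{lr i})` — ⇒ some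
`f ∈ SmallCircuits ℂ (h+h) (c+3)` makes the layout matrix of item 19717 nonsingular (`h ≥ 1`). -/
theorem partitionMinor_hit_of_automorphicStrata (c m : ℕ) (hh : 1 ≤ h) (hm : m ≤ (h + h) ^ c)
    (u w : Fin r → Finset (Fin h)) (hu : Function.Injective u) (lam mu : Fin h → ℤ)
    (lr lc : Fin r → ℕ) (π : ℕ → ℕ) (e : Equiv.Perm (Fin r)) (he : ∀ i, lc (e i) = π (lr i))
    (hπ : ∀ i j : Fin r, π (lr i) = π (lr j) → lr i = lr j) (hlr : ∀ i, lr i < m)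
    (cr cc : ℕ → ℤ) (hcr : Monotone cr) (hcc : Monotone cc)
    (hrow : ∀ i, cr (lr i) < ∑ a ∈ u i, lam a ∧ ∑ a ∈ u i, lam a ≤ cr (lr i + 1))
    (hcol : ∀ j, cc (lc j) < ∑ c ∈ w j, mu c ∧ ∑ c ∈ w j, mu c ≤ cc (lc j + 1))
    (σ : ℕ → Equiv.Perm (Fin h)) (S : ℕ → Finset (Fin h))
    (hw : ∀ i, w (e i) = (symmDiff (u i) (S (lr i))).image (σ (lr i))) :
    ∃ f ∈ SmallCircuits ℂ (h + h) (c + 3),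
      (Matrix.of fun i j : Fin r => MvPolynomial.coeff
        (∑ a ∈ u i, Finsupp.single (Fin.castAdd h a) 1 +
          ∑ c ∈ w j, Finsupp.single (Fin.natAdd h c) 1) f).det ≠ 0 := by
  classical
  set F : ℕ → MvPolynomial (Fin (h + h)) ℂ := fun t =>
    ∏ a : Fin h, (if a ∈ S t then MvPolynomial.X (Fin.natAdd h (σ t a)) + MvPolynomial.X (Fin.castAdd h a)
      else 1 + MvPolynomial.X (Fin.castAdd h a) * MvPolynomial.X (Fin.natAdd h (σ t a))) with hF
  have hFsc : ∀ t, F t ∈ SmallCircuits ℂ (h + h) 2 := fun t => twistedDiag_mem_smallCircuits hh (σ t) (S t)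
  obtain ⟨f, hdeg, hsize, hne⟩ := partitionMinor_hit_of_strata_perm m u w lam mu lr lc π e he hπ hlr
    cr cc hcr hcc hrow hcol F (fun t _ =>
      cell_det_twistedDiag_ne_zero' u w hu lr e t (σ t) (S t) (fun i => by rw [hw i.1, i.2]))
  refine ⟨f, ⟨?_, ?_⟩, hne⟩
  · exact hdeg.trans (Finset.sup_le fun t _ => (hFsc t).1)
  · refine hsize.trans ?_
    calc ∑ t ∈ Finset.range m, complexity (F t) + m * (h + h + 2)
        ≤ ∑ _t ∈ Finset.range m, (h + h) ^ 2 + m * (h + h + 2) := by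
          gcongr with t _
          exact (hFsc t).2
      _ = m * ((h + h) ^ 2 + (h + h) + 2) := by
          rw [Finset.sum_const, Finset.card_range, smul_eq_mul]; ring
      _ ≤ (h + h) ^ (c + 2 + 1) := strata_budget c 2 m hh le_rfl hm
      _ = (h + h) ^ (c + 3) := by ring_nf

/-! ## 3. Unions of Hamming-weight classes -/

/-- **Unions of Hamming-weight classes are hit** (`b = 4`, `h ≥ 1`): if the rows are ALL the
subsets with cardinality in `A` and the columns ALL the subsets with cardinality in `τ(A)`, where
`τ k ∈ {k, h − k}` for `k ∈ A` and `τ` is injective on `A`, then some `f ∈ SmallCircuits ℂ (h+h) 4`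
makes the layout matrix of item 19717 nonsingular. Contains the 19616-irreducible census examples
`W₀∪W₁ v W₀∪W₃` (`h=4`), `W₁∪W₂ v W₁∪W₃`, `W₁∪W₅ v W₄∪W₅` (`h=5`) of kit j253855. -/
theorem partitionMinor_hit_of_weightClasses (hh : 1 ≤ h) (u w : Fin r → Finset (Fin h))
    (hu : Function.Injective u) (A : Finset ℕ) (τ : ℕ → ℕ)
    (hτ : ∀ k ∈ A, τ k = k ∨ τ k = h - k) (hτinj : ∀ k ∈ A, ∀ k' ∈ A, τ k = τ k' → k = k')
    (hU : ∀ T : Finset (Fin h), (∃ i, u i = T) ↔ T.card ∈ A)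
    (hW : ∀ T : Finset (Fin h), (∃ j, w j = T) ↔ ∃ k ∈ A, T.card = τ k) :
    ∃ f ∈ SmallCircuits ℂ (h + h) 4,
      (Matrix.of fun i j : Fin r => MvPolynomial.coeff
        (∑ a ∈ u i, Finsupp.single (Fin.castAdd h a) 1 +
          ∑ c ∈ w j, Finsupp.single (Fin.natAdd h c) 1) f).det ≠ 0 := by
  classical
  have hcardA : ∀ i, (u i).card ∈ A := fun i => (hU (u i)).mp ⟨i, rfl⟩
  -- the automorphic target of a row: itself (principal stratum) or its complement (antipodal)
  set T : Fin r → Finset (Fin h) := fun i => if τ (u i).card = (u i).card then u i else (u i)ᶜ with hT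
  have hTcard : ∀ i, (T i).card = τ (u i).card := by
    intro i
    by_cases hc : τ (u i).card = (u i).card
    · simp only [hT, if_pos hc, hc]
    · rcases hτ _ (hcardA i) with h1 | h1
      · exact absurd h1 hc
      · simp only [hT, if_neg hc, Finset.card_compl, Fintype.card_fin, h1]
  have hTinj : Function.Injective T := by
    intro i i' hii
    have hc : (u i).card = (u i').card := by
      have := congrArg Finset.card hii
      rw [hTcard, hTcard] at this
      exact hτinj _ (hcardA i) _ (hcardA i') this
    apply hu
    have hii' : (if τ (u i').card = (u i').card then u i else (u i)ᶜ) =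
        (if τ (u i').card = (u i').card then u i' else (u i')ᶜ) := by
      have := hii
      simp only [hT] at this
      rwa [hc] at this
    by_cases hb : τ (u i').card = (u i').card
    · rwa [if_pos hb, if_pos hb] at hii'
    · rw [if_neg hb, if_neg hb] at hii'
      exact compl_injective hii'
  have hTex : ∀ i, ∃ j, w j = T i := fun i => (hW (T i)).mpr ⟨(u i).card, hcardA i, hTcard i⟩
  choose e₀ he₀ using hTex
  have he₀inj : Function.Injective e₀ := fun i i' hii =>
    hTinj (by rw [← he₀ i, ← he₀ i', hii])
  set e : Equiv.Perm (Fin r) := Equiv.ofBijective e₀ (Finite.injective_iff_bijective.mp he₀inj) with he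
  have he_apply : ∀ i, e i = e₀ i := fun i => rfl
  -- strata = cardinalities, weights λ = μ = 𝟙, cuts `t - 1`
  have hmono : Monotone (fun t : ℕ => (t : ℤ) - 1) := fun a b hab => by
    show (a : ℤ) - 1 ≤ (b : ℤ) - 1
    omega
  have hsum1 : ∀ X : Finset (Fin h), (∑ _a ∈ X, (1 : ℤ)) = X.card := fun X => by simp
  obtain ⟨f, hf, hne⟩ := partitionMinor_hit_of_automorphicStrata (r := r) 1 (h + 1) hh
    (by rw [pow_one]; omega) u w hu (fun _ => 1) (fun _ => 1)
    (fun i => (u i).card) (fun j => (w j).card) τ e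
    (fun i => by rw [he_apply, he₀, hTcard])
    (fun i j hij => hτinj _ (hcardA i) _ (hcardA j) hij)
    (fun i => Nat.lt_succ_of_le ((Finset.card_le_univ _).trans (by simp)))
    (fun t => (t : ℤ) - 1) (fun t => (t : ℤ) - 1) hmono hmono
    (fun i => by rw [hsum1]; push_cast; constructor <;> linarith)
    (fun j => by rw [hsum1]; push_cast; constructor <;> linarith)
    (fun _ => Equiv.refl _) (fun t => if τ t = t then ∅ else Finset.univ)
    (fun i => by
      rw [he_apply, he₀, Equiv.coe_refl, Finset.image_id]
      by_cases hc : τ (u i).card = (u i).card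
      · simp only [hT, if_pos hc]
        ext a
        simp [Finset.mem_symmDiff]
      · simp only [hT, if_neg hc]
        ext a
        simp [Finset.mem_symmDiff])
  exact ⟨f, by simpa using hf, hne⟩

end Summit.ValiantsHypothesis.ValiantsHypothesis.Theorems.BarrierLever.StrataDoor
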